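import Mathlib
import HarnessLib
import Summits.Ventures.LatticeQCDFlow.Scaling.SU2IdentityFlowAcceptanceMonotone
import Summits.Ventures.LatticeQCDFlow.Scaling.IdentityFlowAcceptanceStrongCoupling

/-!
# LatticeQCDFlow / Scaling — strong-coupling law of the untrained factorised SU(2) sampler's
# acceptance: `(1 − acc_V(β))/β → ½·E|Σᵢ cos αᵢ − Σᵢ cos α′ᵢ|` under the product class-angle Haar law

HONEST FRAMING: exact (Metropolis-corrected) sampling algorithms for lattice gauge theory;
figures of merit are autocorrelation/cost numbers at stated couplings and volumes; no
continuum-physics claim.  Unit `pub-lqcd-s0-u1-a`, GEN-17, file (O); corollary of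
`Scaling/IdentityFlowAcceptanceStrongCoupling` (D) in the class-angle chart of
`Scaling/SU2IdentityFlowVolumeLaw` / `Scaling/SU2IdentityFlowAcceptanceMonotone` (H).  No definition.

The SU(2) one-plaquette class-angle Haar law has the NON-constant density `(2/π) sin² α` on
`(0, π]`, so D's U(1) bookkeeping (constant density) does not apply verbatim; instead the product
Haar class law is written as the probability measure
`μ₂ := (Lebesgue^{⊗V}|_{(0,π]^V}).withDensity(∏ᵢ (2/π) sin² αᵢ)` and D's general law
`tiltIMH_one_sub_meanAccept_div_tendsto` is applied to `μ₂` and `T = Σᵢ cos αᵢ`: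

* `onePlaquetteZSU2_zero` (`Z₂(0) = π/2`), `integral_su2HaarClassDensity` (`∫ Q = 1`),
  `su2HaarClass_isProbabilityMeasure`, `integral_su2HaarClass` (`∫ f dμ₂ = ∫ Q·f`),
  `integrable_exp_mul_su2HaarClass` (all exponential moments of `T` under `μ₂`);
* **`su2IdentityFlow_one_sub_meanAccept_div_tendsto`**: for every finite plaquette set,
  `(1 − acc_V(β))/β → ½ ∫∫ Q(α)Q(α′)|Σᵢ cos αᵢ − Σᵢ cos α′ᵢ| dα dα′` as `β → 0⁺` — the acceptance of
  the untrained SU(2) sampler (H's `su2IdentityFlow_meanAccept_antitoneOn` says it is non-increasing,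
  K's that it is strictly decreasing) leaves `1` LINEARLY, with slope half the Gini mean difference
  of the total plaquette cosine under product class-angle Haar.
-/

noncomputable section

namespace Summit.Ventures.LatticeQCDFlow.Theory2

open MeasureTheory Real Set Finset Filter Topology
open Summit.Ventures.LatticeQCDFlow.Scoring (onePlaquetteZSU2 onePlaquetteZSU2_pos)

section SU2

variable {ι : Type*} [Fintype ι]

/-- `Z₂(0) = ∫₀^π sin² α dα = π/2`. [folklore] -/
theorem onePlaquetteZSU2_zero : onePlaquetteZSU2 0 = π / 2 := by
  simp only [onePlaquetteZSU2, zero_mul, Real.exp_zero, mul_one]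
  rw [integral_sin_sq, Real.sin_zero, Real.sin_pi]
  ring

/-- The product class-angle Haar density `Q(α) = ∏ᵢ (2/π) sin² αᵢ` integrates to `1` on `(0, π]^V`.
[folklore] -/
theorem integral_su2HaarClassDensity :
    ∫ x, ∏ i, 2 / π * Real.sin (x i) ^ 2 ∂(Measure.pi fun _ : ι => volume.restrict (Ioc (0 : ℝ) π))
      = 1 := by
  obtain ⟨-, -, -, -, hM⟩ := su2IdentityFlow_tilt_facts (ι := ι)
  have h := hM 0
  simp only [zero_mul, Real.exp_zero, mul_one] at h
  rw [h, onePlaquetteZSU2_zero, show 2 / π * (π / 2) = (1 : ℝ) by field_simp, one_pow]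

/-- `Q` is Lebesgue integrable on `(0, π]^V`. [folklore] -/
theorem integrable_su2HaarClassDensity :
    Integrable (fun x : ι → ℝ => ∏ i, 2 / π * Real.sin (x i) ^ 2)
      (Measure.pi fun _ : ι => volume.restrict (Ioc (0 : ℝ) π)) := by
  obtain ⟨-, -, -, hint, -⟩ := su2IdentityFlow_tilt_facts (ι := ι)
  exact (hint 0).congr (ae_of_all _ fun x => by simp only [zero_mul, Real.exp_zero, mul_one])

/-- **The product class-angle Haar law `μ₂ = Q · Lebesgue^{⊗V}` on `(0, π]^V` is a probability
measure.** [folklore] -/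
theorem su2HaarClass_isProbabilityMeasure :
    IsProbabilityMeasure ((Measure.pi fun _ : ι => volume.restrict (Ioc (0 : ℝ) π)).withDensity
      fun x => ENNReal.ofReal (∏ i, 2 / π * Real.sin (x i) ^ 2)) := by
  obtain ⟨hq, -, -⟩ := su2IdentityFlow_tilt_facts (ι := ι)
  constructor
  rw [withDensity_apply _ MeasurableSet.univ, Measure.restrict_univ,
    ← ofReal_integral_eq_lintegral_ofReal integrable_su2HaarClassDensity (ae_of_all _ hq),
    integral_su2HaarClassDensity, ENNReal.ofReal_one]

/-- Integration against `μ₂` is integration of `Q·f` against Lebesgue. [folklore] -/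
theorem integral_su2HaarClass (f : (ι → ℝ) → ℝ) :
    ∫ x, f x ∂((Measure.pi fun _ : ι => volume.restrict (Ioc (0 : ℝ) π)).withDensity
        fun x => ENNReal.ofReal (∏ i, 2 / π * Real.sin (x i) ^ 2))
      = ∫ x, (∏ i, 2 / π * Real.sin (x i) ^ 2) * f x
          ∂(Measure.pi fun _ : ι => volume.restrict (Ioc (0 : ℝ) π)) := by
  obtain ⟨hq, hqm, -⟩ := su2IdentityFlow_tilt_facts (ι := ι)
  rw [integral_withDensity_eq_integral_toReal_smul hqm.ennreal_ofReal
    (ae_of_all _ fun _ => ENNReal.ofReal_lt_top)]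
  exact integral_congr_ae (ae_of_all _ fun x => by
    simp only [smul_eq_mul, ENNReal.toReal_ofReal (hq x)])

/-- All exponential moments of `T = Σᵢ cos αᵢ` under `μ₂`. [folklore] -/
theorem integrable_exp_mul_su2HaarClass (γ : ℝ) :
    Integrable (fun x : ι → ℝ => Real.exp (γ * ∑ i, Real.cos (x i)))
      ((Measure.pi fun _ : ι => volume.restrict (Ioc (0 : ℝ) π)).withDensity
        fun x => ENNReal.ofReal (∏ i, 2 / π * Real.sin (x i) ^ 2)) := by
  obtain ⟨hq, hqm, -, hint, -⟩ := su2IdentityFlow_tilt_facts (ι := ι)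
  exact (integrable_withDensity_iff_integrable_smul' hqm.ennreal_ofReal
    (ae_of_all _ fun _ => ENNReal.ofReal_lt_top)).2
    ((hint γ).congr (ae_of_all _ fun x => by
      simp only [smul_eq_mul, ENNReal.toReal_ofReal (hq x)]))

/-- **STRONG-COUPLING LAW OF THE UNTRAINED FACTORISED SU(2) SAMPLER'S ACCEPTANCE**: for every
finite plaquette set, the equilibrium acceptance `acc_V(β)` of Haar-class proposals against `V`
independent SU(2) Wilson plaquettes (`Scaling/SU2IdentityFlowVolumeLaw`) satisfies
`(1 − acc_V(β))/β → ½ ∫ Q(α) ∫ Q(α′)·|Σᵢ cos αᵢ − Σᵢ cos α′ᵢ| dα′ dα` as `β → 0⁺`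
(`Q = ∏ᵢ (2/π) sin² αᵢ`): half the Gini mean difference of the total plaquette cosine under the
product class-angle Haar law — a FIRST-order departure, as for U(1) and every Wilson theory. [ours] -/
theorem su2IdentityFlow_one_sub_meanAccept_div_tendsto :
    Tendsto (fun β : ℝ => (1 - ∫ x, ∫ x',
        min ((∏ i : ι, Real.sin (x i) ^ 2 * Real.exp (β * Real.cos (x i)) / onePlaquetteZSU2 β)
              * ∏ i : ι, (2 / π * Real.sin (x' i) ^ 2))
          ((∏ i : ι, Real.sin (x' i) ^ 2 * Real.exp (β * Real.cos (x' i)) / onePlaquetteZSU2 β)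
              * ∏ i : ι, (2 / π * Real.sin (x i) ^ 2))
        ∂(Measure.pi fun _ : ι => volume.restrict (Ioc (0 : ℝ) π))
        ∂(Measure.pi fun _ : ι => volume.restrict (Ioc (0 : ℝ) π))) / β)
      (𝓝[>] 0)
      (𝓝 (1 / 2 * ∫ x, (∏ i : ι, 2 / π * Real.sin (x i) ^ 2)
          * ∫ x', (∏ i : ι, 2 / π * Real.sin (x' i) ^ 2) * |∑ i, Real.cos (x i) - ∑ i, Real.cos (x' i)|
        ∂(Measure.pi fun _ : ι => volume.restrict (Ioc (0 : ℝ) π))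
        ∂(Measure.pi fun _ : ι => volume.restrict (Ioc (0 : ℝ) π)))) := by
  haveI := su2HaarClass_isProbabilityMeasure (ι := ι)
  obtain ⟨-, -, hTm, -, -⟩ := su2IdentityFlow_tilt_facts (ι := ι)
  have h := tiltIMH_one_sub_meanAccept_div_tendsto
    (μ := (Measure.pi fun _ : ι => volume.restrict (Ioc (0 : ℝ) π)).withDensity
      fun x => ENNReal.ofReal (∏ i, 2 / π * Real.sin (x i) ^ 2))
    (T := fun x : ι → ℝ => ∑ i, Real.cos (x i)) hTm one_pos
    (fun γ _ => integrable_exp_mul_su2HaarClass γ)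
  simp_rw [integral_su2HaarClass] at h
  refine h.congr' (Eventually.of_forall fun β => ?_)
  beta_reduce
  rw [su2IdentityFlow_meanAccept_eq_ratio β]
  simp_rw [← integral_const_mul, mul_assoc]

end SU2

end Summit.Ventures.LatticeQCDFlow.Theory2
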